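import Summits.AtomisticToContinuum.Crystallization.Theorems.FluxTubeKeplerFloorGivesLayered
import Summits.AtomisticToContinuum.Crystallization.Theorems.FluxTubeKeplerFluxCellKeplerSingleScale
import Summits.AtomisticToContinuum.Crystallization.Theorems.ChessboardParticlePlanesPeriodicWindowsIffCrystallization
import Summits.AtomisticToContinuum.Crystallization.Theorems.ChessboardParticlePlanesLjLaminarWindowsMinDistance
import Summits.AtomisticToContinuum.Crystallization.Theorems.PricedLinkCensusChargedEnergyGapDeficitSplit

/-!
# Line `DeepDeficitRung` (the CAP / currency ladder) — skeleton for the forward rung over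
`FluxTubeKepler.FloorGivesLayered` (crux dir `FluxCellKepler`, stmt-AtomisticToContinuum-15221; fwd-rung G1 gen 15,
seed g1-AtomisticToContinuum-15223)

FLOOR (proved, `FluxTubeKeplerFloorGivesLayered.FloorGivesLayered_proof`): for every periodic `P₀`, FLOOR(P₀)
(`N·e(P₀) ≤ E(x)` on Lennard-Jones ground states) and the defect BUDGET
`c(R,η) · #{(R,η)-non-layered sites of x} ≤ E(x) − N·e(P₀)` force layered, hence periodic, windows.
The budget's right-hand side — its CURRENCY — is the NET excess `E(x) − N·e(P₀) = ∑ᵢ (½𝓔ⁱ(x) − e(P₀))`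
(`two_mul_interactionEnergy`), in which DEFICIT sites (`½𝓔ⁱ < e(P₀)`: bound more strongly than the bulk value)
subsidise the certificate in full.  Fourteen earlier generations dialled WHICH sites are priced, HOW MUCH, on WHICH
configurations, the window SHAPE and the certificate CATEGORY (`Lines/*Rung.lean`); none dialled the currency.

ONE MOVE.  `CapRung θ` (`θ : WithTop ℝ`): the currency becomes the CAPPED excess `∑ᵢ max(½𝓔ⁱ(x) − e(P₀), −θ)` —
a deficit subsidises the certificate only down to depth `θ`.  `θ = ⊤` is the floor verbatim (`capRung_top`, F3);
the family is monotone (`capRung_mono`: smaller `θ` = larger right-hand side = weaker hypothesis = stronger rung);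
every member is implied by `Crystallization` (`capRung_of_crystallization`, F4); `θ < 0` is summit-strength
(the budget becomes satisfiable by huge `c`, "attainment ⇒ crystallization") and `θ = 0` (surplus-only currency,
`DeficitBlindRung`) is the far end of the ladder.  DECIDING RUNG: `DeepDeficitRung := CapRung (1/4)` — a Kepler
certificate need never pay for a site over-bound by more than `1/4` below the bulk value.

WHY THE FLOOR'S PROOF STOPS.  `eventually_exists_not_bad` needs `c·#bad ≤ E − N·e(P₀) = o(N)` (`crysEnergyLimit`);
with the capped currency the right-hand side is `(E − N e⋆) + ∑ᵢ (deficitᵢ − 1/4)⁺` and the second sum is NOT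
known to be `o(N)` along ground states: nothing in the tree prices OVER-binding.  THE LOCATED INPUT (two stubs):
(1) `stub_deficitForcesSqueeze` — in a `7/10`-separated configuration a site over-bound by more than `1/4` sees a
SQUEEZED pair (`< 19/20`) within distance `3` (local, certified numerics: kissing-type count + shell sums);
(2) `stub_squeezePriced` — squeeze-adjacent sites are priced by the net excess, `γ·#{squeeze-adjacent} ≤ E − N e⋆`
on `7/10`-separated configurations (global; the bet).  With the tree's hard core `7/10` for ground states
(`LjLaminarWindowsSketch.stub_minDistance07`) and the partial-site-sum bound `neg_le_sum_lennardJones`, the capped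
budget at depth `1/4` then yields the floor's budget with constant `c·γ/(γ + D)` and the seed concludes
(`DeepDeficitRung_of`, sorry-free).

Disproof.lean honoured: §2b (FLOOR kept verbatim as a hypothesis — no member weakens it), §5 (`∀ R η ∃ c`, no
uniformity in `R`: `not_dom_and_keplerUniformR` untouched), §6 (`periodicPricing`: the capped currency only
ENLARGES the right-hand side, so every periodic-pricing witness against the floor's budget remains a witness
against nothing here).  No `_false_without_` theorem of the crux concerns the currency.
-/

noncomputable section

namespace Summit.AtomisticToContinuum.Crystallization.Cruxes.FluxCellKepler.CapLadder

open Filter Topology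
open Literature.MathematicalPhysics.StatisticalMechanics
open Summit.AtomisticToContinuum.Crystallization.Theorems.FluxCellKeplerSingleScale (LayeredGood)

local notation "E3" => EuclideanSpace ℝ (Fin 3)

/-- FLOOR(P₀): `N · e(P₀) ≤ E(x)` for every Lennard-Jones ground state `x` of every size `N`
(verbatim the first hypothesis of `FluxTubeKepler.FloorGivesLayered`). -/
def Floor (P₀ : PeriodicConfiguration 3) : Prop :=
  ∀ (N : ℕ) (x : Fin N → E3), IsGroundState lennardJones x →
    (N : ℝ) * P₀.energyPerParticle lennardJones ≤ interactionEnergy lennardJones x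

/-- The capped site excess: the value `s` itself when `θ = ⊤` (no cap), else `max s (−θ)`
(a deficit deeper than `θ` counts only as `−θ`). -/
def capExcess (θ : WithTop ℝ) (s : ℝ) : ℝ := WithTop.recTopCoe s (fun t : ℝ => max s (-t)) θ

@[simp] theorem capExcess_top (s : ℝ) : capExcess ⊤ s = s := rfl

@[simp] theorem capExcess_coe (t s : ℝ) : capExcess (t : WithTop ℝ) s = max s (-t) := rfl

/-- The site excess of site `i` over the reference energy per particle of `P₀`: `½𝓔ⁱ(x) − e(P₀)`. -/
def siteExcess (P₀ : PeriodicConfiguration 3) {N : ℕ} (x : Fin N → E3) (i : Fin N) : ℝ :=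
  siteEnergy lennardJones x i / 2 - P₀.energyPerParticle lennardJones

/-- CAPPED BUDGET with cap depth `θ`: for every radius `R > 0` and tolerance `η > 0` some `c > 0` prices the
`(R,η)`-non-layered sites of every Lennard-Jones ground state against the CAPPED excess
`∑ᵢ capExcess θ (½𝓔ⁱ(x) − e(P₀))` (`θ = ⊤`: the floor's budget, `LayeredGood` = the crux's defect predicate,
quantifier order `∀ R η ∃ c` of the crux kept). -/
def CapBudget (θ : WithTop ℝ) (P₀ : PeriodicConfiguration 3) : Prop :=
  ∀ R η : ℝ, 0 < R → 0 < η → ∃ c : ℝ, 0 < c ∧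
    ∀ (N : ℕ) (x : Fin N → E3), IsGroundState lennardJones x →
      c * (Nat.card {i : Fin N // ¬ LayeredGood R η x i} : ℝ) ≤ ∑ i, capExcess θ (siteExcess P₀ x i)

/-- Periodic windows at every scale along the sequence `x` (ONE periodic `P`, translations only) —
verbatim the conclusion of `FluxTubeKepler.PeriodicWindows` / `FluxTubeKepler.PeriodicGivenLayered`. -/
def HasPeriodicWindows (x : (N : ℕ) → (Fin N → E3)) : Prop :=
  ∃ P : PeriodicConfiguration 3, ∀ R ε : ℝ, 0 < ε → ∃ᶠ N in atTop, ∃ t : E3,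
    (∀ q ∈ P.points, ‖q‖ ≤ R → ∃ i : Fin N, dist (x N i + t) q ≤ ε) ∧
    (∀ i : Fin N, ‖x N i + t‖ ≤ R → ∃ q ∈ P.points, dist (x N i + t) q ≤ ε)

/-- **The graded family.** `CapRung θ`: FLOOR and the capped budget with cap depth `θ` force periodic windows
along every Lennard-Jones ground-state sequence. -/
def CapRung (θ : WithTop ℝ) : Prop :=
  ∀ P₀ : PeriodicConfiguration 3, Floor P₀ → CapBudget θ P₀ →
    ∀ x : (N : ℕ) → (Fin N → E3), (∀ N, IsGroundState lennardJones (x N)) → HasPeriodicWindows x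

/-- **Deciding rung** (cap depth `1/4`): a certificate that never pays for a site over-bound by more than
`1/4` below the bulk value still forces crystallization of the ground states. -/
def DeepDeficitRung : Prop := CapRung ((1 / 4 : ℝ) : WithTop ℝ)

/-- The far member of the ladder (cap depth `0`, surplus-only currency), recorded for `LADDER.md`. -/
def DeficitBlindRung : Prop := CapRung ((0 : ℝ) : WithTop ℝ)

/-! ## F3 — the family specialises to the proved floor -/

/-- The net currency: `∑ᵢ (½𝓔ⁱ(x) − e(P₀)) = E(x) − N·e(P₀)` (double counting `2E = ∑ᵢ 𝓔ⁱ`). -/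
theorem sum_siteExcess (P₀ : PeriodicConfiguration 3) {N : ℕ} (x : Fin N → E3) :
    ∑ i, siteExcess P₀ x i =
      interactionEnergy lennardJones x - (N : ℝ) * P₀.energyPerParticle lennardJones := by
  have h := two_mul_interactionEnergy lennardJones x
  simp only [siteExcess, Finset.sum_sub_distrib, Finset.sum_const, Finset.card_univ, Fintype.card_fin,
    nsmul_eq_mul, ← Finset.sum_div, ← h]
  ring

/-- At cap depth `⊤` the capped budget IS the floor's budget. -/
theorem capBudget_top_iff (P₀ : PeriodicConfiguration 3) :
    CapBudget ⊤ P₀ ↔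
      ∀ R η : ℝ, 0 < R → 0 < η → ∃ c : ℝ, 0 < c ∧
        ∀ (N : ℕ) (x : Fin N → E3), IsGroundState lennardJones x →
          c * (Nat.card {i : Fin N // ¬ LayeredGood R η x i} : ℝ) ≤
            interactionEnergy lennardJones x - (N : ℝ) * P₀.energyPerParticle lennardJones := by
  simp only [CapBudget, capExcess_top, sum_siteExcess]

/-- `CapRung ⊤` is the floor: the seed theorem followed by the proved `PeriodicGivenLayered`. -/
theorem capRung_top : CapRung ⊤ := fun P₀ hF hB x hx =>
  Theses.FluxTubeKepler.PeriodicGivenLayered_holds x hx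
    (Theorems.FluxTubeKeplerFloorGivesLayered.FloorGivesLayered_proof P₀ hF
      ((capBudget_top_iff P₀).1 hB) x hx)

/-! ## Dial monotonicity (harder-to-easier = increasing cap depth) -/

/-- The capped excess is antitone in the cap depth. -/
theorem capExcess_anti {θ θ' : WithTop ℝ} (h : θ ≤ θ') (s : ℝ) : capExcess θ' s ≤ capExcess θ s := by
  induction θ' using WithTop.recTopCoe with
  | top =>
    induction θ using WithTop.recTopCoe with
    | top => exact le_rfl
    | coe t => simp only [capExcess_top, capExcess_coe]; exact le_max_left s (-t)
  | coe t' =>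
    induction θ using WithTop.recTopCoe with
    | top => exact absurd h (by simp)
    | coe t =>
      have htt : t ≤ t' := by exact_mod_cast h
      simp only [capExcess_coe]
      exact max_le_max le_rfl (neg_le_neg htt)

/-- A capped budget with a deeper cap (larger `θ`) is a stronger hypothesis. -/
theorem capBudget_anti {θ θ' : WithTop ℝ} (h : θ ≤ θ') {P₀ : PeriodicConfiguration 3} :
    CapBudget θ' P₀ → CapBudget θ P₀ := by
  intro hB R η hR hη
  obtain ⟨c, hc, hcN⟩ := hB R η hR hη
  exact ⟨c, hc, fun N x hx => (hcN N x hx).trans (Finset.sum_le_sum fun i _ => capExcess_anti h _)⟩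

/-- `CapRung` is monotone in the cap depth: a smaller `θ` is the stronger rung. -/
theorem capRung_mono {θ θ' : WithTop ℝ} (h : θ ≤ θ') : CapRung θ → CapRung θ' :=
  fun H P₀ hF hB x hx => H P₀ hF (capBudget_anti h hB) x hx

/-- The deciding rung gives back the floor member (informational `specialises`). -/
theorem capRung_top_of_deepDeficitRung (h : DeepDeficitRung) : CapRung ⊤ := capRung_mono le_top h

/-- Lattice position: the far member implies the deciding rung. -/
theorem deepDeficitRung_of_deficitBlindRung (h : DeficitBlindRung) : DeepDeficitRung :=
  capRung_mono (by exact_mod_cast (by norm_num : (0 : ℝ) ≤ 1 / 4)) h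

/-! ## F4 — on-path lemmas: the sub-problem implies every member -/

/-- ON-PATH: `Crystallization → CapRung θ` (landed hull-criterion converse
`periodicWindows_of_crystallization`). -/
theorem capRung_of_crystallization (θ : WithTop ℝ) (h : _root_.Crystallization) : CapRung θ :=
  fun _ _ _ x hx =>
    Theorems.ChessboardParticlePlanesPeriodicWindowsIffCrystallization.periodicWindows_of_crystallization h x hx

/-- ON-PATH for the deciding rung (tagged `aesop safe apply` so that the tribunal's fixed `S → C` portfolio —
`simpa using h`, `aesop` — finds it). -/
@[aesop safe apply]
theorem DeepDeficitRung_of_Crystallization (h : _root_.Crystallization) : DeepDeficitRung :=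
  capRung_of_crystallization _ h

theorem DeficitBlindRung_of_Crystallization (h : _root_.Crystallization) : DeficitBlindRung :=
  capRung_of_crystallization _ h


/-! ## The located new input — pricing OVER-binding (two declared stubs)

Notation: `e⋆ = eStar = ⨅_Q e(Q)`; under FLOOR(P₀) one has `e(P₀) = e⋆` (`floor_iff_eq_eStar`), so the deficit of
site `i` is `e⋆ − ½𝓔ⁱ(x)`.  A site is SQUEEZE-ADJACENT if two distinct particles within distance `3` of it are
closer than `19/20` (the relaxed nearest-neighbour distance is `a⋆ ≈ 0.9713`). -/

open Summit.AtomisticToContinuum.Crystallization.Theorems.ChargedEnergyGapNegative (eStar)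

/-- Site `i` of `x` is squeeze-adjacent: some pair `j ≠ k`, both within distance `3` of `x i`, has
`dist (x j) (x k) < 19/20`. -/
def SqueezeAdj {N : ℕ} (x : Fin N → E3) (i : Fin N) : Prop :=
  ∃ j k : Fin N, j ≠ k ∧ dist (x i) (x j) ≤ 3 ∧ dist (x i) (x k) ≤ 3 ∧ dist (x j) (x k) < 19 / 20

/-- **Stub 1 — DEEP DEFICIT FORCES A SQUEEZE (local; M, certified numerics).**  In a `7/10`-separated finite
configuration, a site over-bound by more than `1/4` below `e⋆` (`½𝓔ⁱ < e⋆ − 1/4`, i.e. `𝓔ⁱ < 2e⋆ − 1/2 ≈ −1.935`)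
is squeeze-adjacent.  Contrapositive: if all particles within `3` of `x i` (including `x i`) are pairwise
`≥ 19/20` apart, then on the sphere of radius `1` at most `13` of them fit (mutual angle `≥ 56.7°`; Tammes:
`14` points force `55.7°`), over the whole first shell `[19/20, 23/20]` at most `≈ 16`, those off `r = 1` giving
strictly more than `−1/12` each; the shells `[23/20, 3]` contribute `≥ −0.45` (packing count
`card_le_of_separated_of_mem_shell` against `−r⁻⁶/6`) and the `7/10`-separated far field beyond `3` at least
`−0.06` (`sum_inv_pow_six_le`) — against the threshold `𝓔ⁱ < 2e⋆ − 1/2 ≈ −1.935` (only the UPPER bound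
`e⋆ ≤ e(fcc, a = 0.9715) < −0.717` is used).  Numerical search (kit job j053619, gradient search over `≤ 70`
points in the ball of radius `2.3`, separation enforced by projection): maximal over-binding `e⋆ − ½𝓔ⁱ` found
`0.58` at separation `7/10`, `0.29` at `4/5`, `0.084` at `0.89`, `0.018` at `0.93` (far field beyond `2.3` adds
`≤ 0.06`): the cap at `1/4` is ACTIVE on the hard-core class `7/10`, while over-binding `> 1/4` appeared only with
pairs `≲ 0.85`, far below `19/20` (a search, not a bound: lower estimates of the maximum); the proof is a finite shell-by-shell interval computation. [folklore; conjecture as typed] -/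
theorem stub_deficitForcesSqueeze :
    ∀ (N : ℕ) (x : Fin N → E3), (∀ j k : Fin N, j ≠ k → (7 : ℝ) / 10 ≤ dist (x j) (x k)) →
      ∀ i : Fin N, siteEnergy lennardJones x i / 2 < eStar - 1 / 4 → SqueezeAdj x i := by
  sorry

/-- **Stub 2 — SQUEEZES ARE PRICED BY THE NET EXCESS (global; L — the bet).**  There is `γ > 0` such that every
`7/10`-separated finite configuration pays `γ` of net excess `E(x) − N·e⋆` per squeeze-adjacent site.  Evidence:
uniform compression of hcp to nearest-neighbour distance `19/20` costs `½·6A·(0.022)² ≈ 0.012` per particle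
(`A ≈ 8.61` the lattice sum, `e'' = 6A`), an isolated squeezed bond in relaxed hcp `≈ 2.6·10⁻³`, a Mackay
icosahedral grain (radial bonds compressed `≈ 5%`) a strain energy `∝` volume; so `γ ≈ 10⁻³/#B(3)` is consistent
with every family we know.  Why it might fail / why it is hard: it is a PRICED FLOOR (compare the open crux
`PricedLinkCensus.ChargedEnergyGap`, which prices mis-coordination instead), so a proof must compare against the
UNKNOWN `e⋆` — by periodisation (`ChargedEnergyGapNegative.Periodisation`) it says that no periodic near-minimiser
has squeezed bonds, quantitatively; the first-shell cost of a squeeze (`6·(V(19/20) − V(a⋆)) ≈ 0.046`/particle)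
beats the densification gain of the tails (`≈ 0.03`) only by a factor `1.5`. [conjecture] -/
theorem stub_squeezePriced :
    ∃ γ : ℝ, 0 < γ ∧ ∀ (N : ℕ) (x : Fin N → E3), (∀ j k : Fin N, j ≠ k → (7 : ℝ) / 10 ≤ dist (x j) (x k)) →
      γ * (Nat.card {i : Fin N // SqueezeAdj x i} : ℝ) ≤ interactionEnergy lennardJones x - (N : ℝ) * eStar := by
  sorry

/-! ### The stub statements as named propositions (verbatim) -/

/-- Statement of `stub_deficitForcesSqueeze` (verbatim). [conjecture] -/
def Sig.stub_deficitForcesSqueeze : Prop :=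
    ∀ (N : ℕ) (x : Fin N → E3), (∀ j k : Fin N, j ≠ k → (7 : ℝ) / 10 ≤ dist (x j) (x k)) →
      ∀ i : Fin N, siteEnergy lennardJones x i / 2 < eStar - 1 / 4 → SqueezeAdj x i

/-- Statement of `stub_squeezePriced` (verbatim). [conjecture] -/
def Sig.stub_squeezePriced : Prop :=
    ∃ γ : ℝ, 0 < γ ∧ ∀ (N : ℕ) (x : Fin N → E3), (∀ j k : Fin N, j ≠ k → (7 : ℝ) / 10 ≤ dist (x j) (x k)) →
      γ * (Nat.card {i : Fin N // SqueezeAdj x i} : ℝ) ≤ interactionEnergy lennardJones x - (N : ℝ) * eStar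

/-! ### The skeleton theorems (sorry-free): capped budget at depth `1/4` ⟹ the floor's budget ⟹ the rung -/

/-- Partial-site-sum bound under the hard core: in a `7/10`-separated configuration every site energy is
`≥ −30375` (the tree's `neg_le_sum_lennardJones` for `1/3`-separated configurations). -/
theorem siteEnergy_ge {N : ℕ} (x : Fin N → E3) (hsep : ∀ j k : Fin N, j ≠ k → (7 : ℝ) / 10 ≤ dist (x j) (x k))
    (i : Fin N) : -(30375 : ℝ) ≤ siteEnergy lennardJones x i := by
  have h3 : ∀ j k : Fin N, j ≠ k → (1 / 3 : ℝ) ≤ dist (x j) (x k) :=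
    fun j k hjk => le_trans (by norm_num) (hsep j k hjk)
  simpa [siteEnergy] using
    Theorems.TwoToleranceSandwichDeficitSplit.neg_le_sum_lennardJones x h3 i (Finset.univ.erase i)

/-- **The currency exchange.**  Under the two stubs, on a `7/10`-separated configuration the capped currency at
depth `1/4` (reference value `e⋆`) is at most `(1 + D/γ)` times the net excess, `D = |e⋆| + 15188`. -/
theorem sum_capExcess_le (h₁ : Sig.stub_deficitForcesSqueeze) {γ : ℝ} (hγ : 0 < γ)
    (h₂ : ∀ (N : ℕ) (x : Fin N → E3), (∀ j k : Fin N, j ≠ k → (7 : ℝ) / 10 ≤ dist (x j) (x k)) →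
      γ * (Nat.card {i : Fin N // SqueezeAdj x i} : ℝ) ≤ interactionEnergy lennardJones x - (N : ℝ) * eStar)
    {N : ℕ} (x : Fin N → E3) (hsep : ∀ j k : Fin N, j ≠ k → (7 : ℝ) / 10 ≤ dist (x j) (x k)) :
    ∑ i, max (siteEnergy lennardJones x i / 2 - eStar) (-(1 / 4 : ℝ)) ≤
      (1 + (|eStar| + 15188) / γ) * (interactionEnergy lennardJones x - (N : ℝ) * eStar) := by
  classical
  set D : ℝ := |eStar| + 15188 with hD
  have hD0 : 0 ≤ D := by positivity
  set A : Finset (Fin N) := Finset.univ.filter (fun i => SqueezeAdj x i) with hA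
  -- pointwise: the capped excess exceeds the plain excess only at squeeze-adjacent sites, by at most `D`
  have hpt : ∀ i : Fin N, max (siteEnergy lennardJones x i / 2 - eStar) (-(1 / 4 : ℝ)) ≤
      (siteEnergy lennardJones x i / 2 - eStar) + (if i ∈ A then D else 0) := by
    intro i
    by_cases hi : SqueezeAdj x i
    · have hmem : i ∈ A := by simp [hA, hi]
      rw [if_pos hmem]
      have hlow := siteEnergy_ge x hsep i
      have habs : eStar ≤ |eStar| := le_abs_self eStar
      refine max_le (by linarith) ?_
      linarith
    · have hmem : i ∉ A := by simp [hA, hi]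
      rw [if_neg hmem, add_zero]
      refine max_le le_rfl ?_
      by_contra hlt
      rw [not_le] at hlt
      exact hi (h₁ N x hsep i (by linarith))
  have hsum : ∑ i, max (siteEnergy lennardJones x i / 2 - eStar) (-(1 / 4 : ℝ)) ≤
      (interactionEnergy lennardJones x - (N : ℝ) * eStar) + D * (A.card : ℝ) := by
    calc ∑ i, max (siteEnergy lennardJones x i / 2 - eStar) (-(1 / 4 : ℝ))
        ≤ ∑ i, ((siteEnergy lennardJones x i / 2 - eStar) + (if i ∈ A then D else 0)) :=
          Finset.sum_le_sum fun i _ => hpt i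
      _ = (interactionEnergy lennardJones x - (N : ℝ) * eStar) + D * (A.card : ℝ) := by
          rw [Finset.sum_add_distrib, Finset.sum_ite_mem, Finset.univ_inter, Finset.sum_const, nsmul_eq_mul,
            mul_comm (A.card : ℝ) D]
          congr 1
          have h := two_mul_interactionEnergy lennardJones x
          simp only [Finset.sum_sub_distrib, Finset.sum_const, Finset.card_univ, Fintype.card_fin,
            nsmul_eq_mul, ← Finset.sum_div, ← h]
          ring
  -- the number of squeeze-adjacent sites is priced by the net excess
  have hcard : (Nat.card {i : Fin N // SqueezeAdj x i} : ℝ) = (A.card : ℝ) := by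
    rw [Nat.card_eq_fintype_card, Fintype.card_subtype, hA]
  have hpr := h₂ N x hsep
  rw [hcard] at hpr
  have hex : 0 ≤ interactionEnergy lennardJones x - (N : ℝ) * eStar := by
    have := mul_nonneg hγ.le (Nat.cast_nonneg (A.card) : (0 : ℝ) ≤ (A.card : ℝ))
    linarith
  have hAc : D * (A.card : ℝ) ≤ D / γ * (interactionEnergy lennardJones x - (N : ℝ) * eStar) := by
    rw [div_mul_eq_mul_div, le_div_iff₀ hγ]
    calc D * (A.card : ℝ) * γ = D * (γ * (A.card : ℝ)) := by ring
      _ ≤ D * (interactionEnergy lennardJones x - (N : ℝ) * eStar) :=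
          mul_le_mul_of_nonneg_left hpr hD0
  calc ∑ i, max (siteEnergy lennardJones x i / 2 - eStar) (-(1 / 4 : ℝ))
      ≤ (interactionEnergy lennardJones x - (N : ℝ) * eStar) + D * (A.card : ℝ) := hsum
    _ ≤ (interactionEnergy lennardJones x - (N : ℝ) * eStar)
          + D / γ * (interactionEnergy lennardJones x - (N : ℝ) * eStar) := by linarith
    _ = (1 + (|eStar| + 15188) / γ) * (interactionEnergy lennardJones x - (N : ℝ) * eStar) := by
          rw [hD]; ring

/-- **Capped ⟹ net.**  Under the two stubs, FLOOR(P₀) and the capped budget at depth `1/4` give the floor's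
(net) budget: ground states are `7/10`-separated (`stub_minDistance07`, landed), `e(P₀) = e⋆`
(`floor_iff_eq_eStar`), and `sum_capExcess_le` exchanges the currency at rate `1 + D/γ`. -/
theorem capBudget_top_of_quarter (h₁ : Sig.stub_deficitForcesSqueeze) (h₂ : Sig.stub_squeezePriced)
    (P₀ : PeriodicConfiguration 3) (hF : Floor P₀) (hB : CapBudget ((1 / 4 : ℝ) : WithTop ℝ) P₀) :
    CapBudget ⊤ P₀ := by
  obtain ⟨γ, hγ, hpr⟩ := h₂
  have heq : P₀.energyPerParticle lennardJones = eStar :=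
    (Theorems.FluxTubeKeplerFloorGivesLayered.floor_iff_eq_eStar P₀).1 hF
  set K : ℝ := 1 + (|eStar| + 15188) / γ with hK
  have hK0 : 0 < K := by positivity
  intro R η hR hη
  obtain ⟨c, hc, hcN⟩ := hB R η hR hη
  refine ⟨c / K, div_pos hc hK0, fun N x hx => ?_⟩
  have hsep : ∀ j k : Fin N, j ≠ k → (7 : ℝ) / 10 ≤ dist (x j) (x k) :=
    fun j k hjk => Theorems.LjLaminarWindowsSketch.stub_minDistance07 N x hx j k hjk
  have h1 := hcN N x hx
  simp only [capExcess_coe, siteExcess, heq] at h1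
  have h2 := sum_capExcess_le h₁ hγ hpr x hsep
  simp only [capExcess_top, sum_siteExcess, heq]
  rw [div_mul_eq_mul_div, div_le_iff₀ hK0]
  calc c * (Nat.card {i : Fin N // ¬ LayeredGood R η x i} : ℝ)
      ≤ K * (interactionEnergy lennardJones x - (N : ℝ) * eStar) := h1.trans h2
    _ = (interactionEnergy lennardJones x - (N : ℝ) * eStar) * K := by ring

/-- **Assembly.** `stub_deficitForcesSqueeze → stub_squeezePriced → DeepDeficitRung`: the capped budget at depth
`1/4` is exchanged for the floor's budget (`capBudget_top_of_quarter`) and the floor member `capRung_top` (seed +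
`PeriodicGivenLayered`) concludes — the rung BY NAME. -/
theorem DeepDeficitRung_of (h₁ : Sig.stub_deficitForcesSqueeze) (h₂ : Sig.stub_squeezePriced) : DeepDeficitRung :=
  fun P₀ hF hB x hx => capRung_top P₀ hF (capBudget_top_of_quarter h₁ h₂ P₀ hF hB) x hx

/-- **The closed skeleton instance**: the rung by name from the two declared stubs (the only `sorry`s of this
file enter here). [conjecture] -/
theorem DeepDeficitRung_skeleton : DeepDeficitRung :=
  DeepDeficitRung_of stub_deficitForcesSqueeze stub_squeezePriced

/-- Registrar alias (`ledger skeleton check --crux-decl …CapLadder.DeepDeficitRung` expects `<Decl>_proof`): the rung by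
name from the two stubs; identical to `DeepDeficitRung_skeleton`. [conjecture] -/
theorem DeepDeficitRung_proof : DeepDeficitRung := DeepDeficitRung_skeleton

end Summit.AtomisticToContinuum.Crystallization.Cruxes.FluxCellKepler.CapLadder

end
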